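import Literature.AlgebraicGeometry.ModuliOfAbelianVarieties.SiegelUniversalTripleOfFlatFamily
import Literature.AlgebraicGeometry.ModuliOfAbelianVarieties.SiegelHilbertBaseWithSections
import Literature.AlgebraicGeometry.ModuliOfAbelianVarieties.SiegelFramedCovariant
import Literature.AlgebraicGeometry.ModuliOfAbelianVarieties.SiegelLinearRigidificationHilbertPolynomial
import Literature.AlgebraicGeometry.ModuliOfAbelianVarieties.SiegelLinearRigidificationProjective
import Literature.AlgebraicGeometry.ModuliOfAbelianVarieties.SiegelLinearRigidificationBaseChange
import Literature.AlgebraicGeometry.AbelianSchemes.MFKIntrinsicOfLinearRigidification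
import Literature.AlgebraicGeometry.AbelianSchemes.PolarizedTripleIsBaseChangeViaOfIso
import Literature.AlgebraicGeometry.AbelianSchemes.AbelianSchemeDualTransportOfBaseChange
import Literature.AlgebraicGeometry.Motives.HilbertImageInGrassmannianUniversalFamily
import HarnessLib

/-!
# The linearly rigidified covariant `H` of [MumfordFogartyKirwan1994] Prop. 7.3 / Prop. 7.6 EXISTS modulo the Hilbert scheme,
# Theorem 6.14 and Corollary 6.8: `Nonempty (SiegelFramedCovariant g N δ J)` — the F-6 exit of the cell's tower

Topic `AlgebraicGeometry/ModuliOfAbelianVarieties`, namespace `Literature.AlgebraicGeometry.ModuliOfAbelianVarieties`.  THEOREMS ONLY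
(no definition, no instance, no notation, no `sorry`).  Cell `hodgecm-mathlib` (D-0151), F-DAG row F-6 (H-rep), file R-C2 = the HEAD
(B-p18 (g19) split 2026-08-30T10:55:54Z; B-p18 (g20) census 5993ee74 / plan 11:51Z).  Written against edition 2 of ★
`PolarizedAbelianSchemeWithLevel` (repair road R2⁺: every triple carries `hatNormalised`, so ★ (8α)'s `represents` quantifies over
MFK's bi-rigidified triples and is TRUE again — cell finding 8aea22b3).

ASSEMBLY.  From the three cores — `hHilb` (the universal flat family of the Hilbert scheme of `𝐏^J` — the conclusion of ★ F-5 ⑦b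
`exists_universal_flat_family_of_vanishingLocus` VERBATIM, Grassmannian immersion included), `hII` ([MumfordFogartyKirwan1994] Thm. 6.14, letter of ★ FILE 2) and `hF3` (Cor. 6.8,
letter of ★ FILE 2):
1. ★ R-C1 `exists_hilbertBase_with_sections` at `S := Spec ℚ`, `n := #(Option (Fin g ⊕ Fin g)) = 2g+1`: the raw base
   `(H₀ →^{f₀} Spec ℚ, p₀ : Z₀ → H₀, i₀ : Z₀ ⊂ 𝐏(J; H₀), τ₀)` of [MumfordFogartyKirwan1994] p. 132 with its universal property with sections;
2. ★ R-A `exists_siegelUniversalTriple_clauses_iff_mfkIntrinsic` (Prop. 7.3 (I)–(VI) + Prop. 7.6): the immersion `jH : H ↪ H₀`, the universal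
   triple `univ` over `H`, `emb := prH ≫ ι₀` a linear rigidification, the clause letters of `univ`, and `(∃! w, w ≫ jH = b) ↔ INT(b)`;
3. `represents`, existence: a linearly rigidified `(P′, ι)` over `T` is a closed flat `X′ ⊂ 𝐏(J; T)` with Hilbert polynomial `(6n)^g d`
   (★ (F4) `IsLinearRigidification.isClosedImmersion_lift`, ★ (R4-poly) `IsLinearRigidification.hasRank_pushforward_twistMod_lift`) and `2g+1`
   sections ⇒ its classifying `b : T → H₀` (step 1) ⇒ INT(b) (★ R-B2b `mfkIntrinsic_of_isLinearRigidification`) ⇒ `w : T → H` (step 2) ⇒ the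
   comparison `(G, Ĝ)`: `G` from the two cartesian squares over `b = w ≫ jH`, and [MumfordFogartyKirwan1994] Prop. 7.3 «`Φ` is injective» in
   triple currency (★ (C1) `exists_isBaseChangeVia_id_of_iso`, fed with the (V) letters of ★ R-B2a on both sides) composed with ★
   `baseChange_isBaseChangeVia`;
4. `represents`, uniqueness: a second relation `(f₁, G₁, Ĝ₁)` classifies the same embedded family with sections, so `f₁ ≫ jH = b` (step 1 `∃!`)
   and `f₁ = w` (step 2 `∃!`).

* **`nonempty_siegelFramedCovariant_of_cores`** — the head.

HC_CM is proved only modulo the 7 printed citations until rung 0 closes; this file DISCHARGES NONE of them (it closes the F-6 row of the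
cell's Mumford line modulo the cores `hHilb`, `hII`, `hF3`).

## References
* [MumfordFogartyKirwan1994] D. Mumford, J. Fogarty, F. Kirwan, *Geometric Invariant Theory*, 3rd ed. (1994), Ch. 7 §2 Proposition 7.3
  (p. 132; proof pp. 132–134), Definition 7.2 (p. 129), Def. 7.5 (p. 130), Prop. 7.6 (p. 136); Ch. 6 §3 Theorem 6.14 (p. 124); Ch. 6 §1
  Corollary 6.8 (p. 118); Ch. 0 §5 (c) (p. 23).
* [Hartshorne1977] R. Hartshorne, *Algebraic Geometry* (1977), II Thm. 7.1 (p. 150).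
-/

noncomputable section

-- Mathlib's `Over`/pull-back API and `Scheme.Modules` are stated across semireducible wrappers (as in ★ (8α), ★ R-A).
set_option backward.isDefEq.respectTransparency false

open CategoryTheory CategoryTheory.Limits AlgebraicGeometry MonoidalCategory MonObj
open scoped MonObj

namespace Literature.AlgebraicGeometry.ModuliOfAbelianVarieties

open Literature.AlgebraicGeometry.AbelianSchemes Literature.AlgebraicGeometry.AbelianSchemes.AbelianSchemeOver
  Literature.AlgebraicGeometry.Motives Literature.AlgebraicGeometry.Motives.GeneratingSections
  Literature.AlgebraicGeometry.Modules Literature.AlgebraicGeometry.Modules.SerreTwist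
  Literature.AlgebraicGeometry.AbelianVarieties Literature.AlgebraicGeometry.Morphisms
  Literature.AlgebraicGeometry.Motives.Grassmannian

/-- `6` is invertible on a `ℚ`-scheme (residue fields have characteristic `0`). [cite: Hartshorne1977, II Prop. 2.3] -/
theorem six_residueField_ne_zero {T : Scheme.{0}} (πT : T ⟶ Spec (.of ℚ)) (t : T) : (6 : T.residueField t) ≠ 0 := by
  let φ : ℚ →+* T.residueField t := (Spec.preimage (T.fromSpecResidueField t ≫ πT)).hom
  have h : ((6 : ℕ) : T.residueField t) ≠ 0 := by
    rw [← map_natCast φ 6]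
    exact (map_ne_zero φ).mpr (Nat.cast_ne_zero.mpr (by norm_num))
  simpa using h

/-- **[MumfordFogartyKirwan1994] Prop. 7.3 / Prop. 7.6 over a GIVEN raw base `Hilb^{P,2g+1}_ℚ`** — the construction with its
structure maps EXPORTED (for the F-9 / Plücker consumers): from the raw data `(f₀ : H₀ → Spec ℚ, p₀ : Z₀ → H₀, i₀ : Z₀ ⊂ 𝐏(J; H₀), τ₀)`
with the universal property with sections (★ R-C1 `exists_hilbertBase_with_sections` produces them from the Hilbert scheme), `hII` and
`hF3`, there are a ★ (8α) `SiegelFramedCovariant g N δ J` `𝓗` TOGETHER WITH an immersion `jH : 𝓗.H ↪ H₀` over `Spec ℚ`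
(`𝓗.H.hom = jH ≫ f₀`), the cartesian square `prH : 𝓗.univ.X → Z₀` over `jH` (so the universal family IS `Z₀ ×_{H₀} H`), the
identification `𝓗.emb = prH ≫ i₀ ≫ pr₂`, the unit / level sections read through `prH` as `τ₀`, and `𝓗.H → Spec ℚ` locally of finite
type. [cite: MumfordFogartyKirwan1994, Ch. 7 §2 Proposition 7.3 (p. 132; proof pp. 132–134)] [cite: MumfordFogartyKirwan1994, Ch. 7 §2 Prop. 7.6 (p. 136)]
[cite: MumfordFogartyKirwan1994, Ch. 6 §3 Theorem 6.14 (p. 124)] [cite: MumfordFogartyKirwan1994, Ch. 6 §1 Corollary 6.8 (p. 118)] -/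
theorem exists_siegelFramedCovariant_of_hilbertBase {g N : ℕ} {δ : Fin g → ℕ} (hN : N ≠ 0) (hδ : IsPolarizationType δ)
    {J : Type} [Finite J] (hJ : Nat.card J + 1 = 6 ^ g * polarizationDegree δ) {e₀ : ℕ} (he₀ : 0 < e₀)
    {H₀ Z₀ : Scheme.{0}} (f₀ : H₀ ⟶ Spec (.of ℚ)) [LocallyOfFiniteType f₀] (p₀ : Z₀ ⟶ H₀)
    (i₀ : Z₀ ⟶ projectiveSpace J H₀) [IsClosedImmersion i₀] (hp₀ : i₀ ≫ projectiveSpaceFst J H₀ = p₀) [Flat p₀]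
    {n : ℕ} (eι : Option (Fin g ⊕ Fin g) ≃ Fin n) (τ₀ : Fin n → (H₀ ⟶ Z₀)) (hτ₀ : ∀ k, τ₀ k ≫ p₀ = 𝟙 H₀)
    -- the universal property with sections of `(H₀, Z₀, τ₀)` over `ℚ`-schemes (★ R-C1)
    (hunivS : ∀ ⦃T : Scheme.{0}⦄ [IsLocallyNoetherian T] (πT : T ⟶ Spec (.of ℚ)) ⦃X : Scheme.{0}⦄
        (i : X ⟶ projectiveSpace J T) [IsClosedImmersion i] [Flat (i ≫ projectiveSpaceFst J T)],
        (∀ e, e₀ ≤ e → HasRank ((Scheme.Modules.pushforward (i ≫ projectiveSpaceFst J T)).obj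
          (twistMod (i ≫ pullback.snd (terminal.from T) (terminal.from (projectiveSpaceInt J))) (unitModule X) e))
          ((6 * e) ^ g * polarizationDegree δ)) →
        ∀ (σ : Fin n → (T ⟶ X)), (∀ k, σ k ≫ i ≫ projectiveSpaceFst J T = 𝟙 T) →
        ∃! b : T ⟶ H₀, b ≫ f₀ = πT ∧
          ∃ pr : X ⟶ Z₀, IsPullback pr (i ≫ projectiveSpaceFst J T) p₀ b ∧
            pr ≫ i₀ ≫ pullback.snd (terminal.from H₀) (terminal.from (projectiveSpaceInt J)) =
              i ≫ pullback.snd (terminal.from T) (terminal.from (projectiveSpaceInt J)) ∧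
            ∀ k, σ k ≫ pr = b ≫ τ₀ k)
    -- `hII` ([MumfordFogartyKirwan1994] Thm. 6.14 with the group law as output DATA; letter of ★ FILE 2 / ★ R-A, verbatim)
    (hII : ∀ ⦃H₁ Z₁ : Scheme.{0}⦄ (p₁ : Z₁ ⟶ H₁) [IsProper p₁] [Smooth p₁] [GeometricallyConnected p₁]
        (f₁ : H₁ ⟶ Spec (.of ℚ)) [LocallyOfFiniteType f₁] (ε₁ : H₁ ⟶ Z₁) (_ : ε₁ ≫ p₁ = 𝟙 H₁),
      ∃ (H₂ : Scheme.{0}) (j₂ : H₂ ⟶ H₁) (_ : IsOpenImmersion j₂) (_ : IsClosed (Set.range j₂))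
        (G : GrpObj (Over.mk (pullback.snd p₁ j₂))),
          (@MonObj.one _ _ _ (Over.mk (pullback.snd p₁ j₂)) G.toMonObj).left ≫ pullback.fst p₁ j₂ = j₂ ≫ ε₁ ∧
          SmoothOfRelativeDimension g (pullback.snd p₁ j₂) ∧
          ∀ ⦃T : Scheme.{0}⦄ (v : T ⟶ H₁),
            (∃! w : T ⟶ H₂, w ≫ j₂ = v) ↔
              ∃ G' : GrpObj (Over.mk (pullback.snd p₁ v)),
                (@MonObj.one _ _ _ (Over.mk (pullback.snd p₁ v)) G'.toMonObj).left ≫ pullback.fst p₁ v = v ≫ ε₁ ∧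
                SmoothOfRelativeDimension g (pullback.snd p₁ v))
    -- `hF3` ([MumfordFogartyKirwan1994] Cor. 6.8 Zariski-locally on the base; letter of ★ FILE 2 / ★ R-A, verbatim)
    (hF3 : ∀ ⦃S : Scheme.{0}⦄ [IsLocallyNoetherian S] (fS : S ⟶ Spec (.of ℚ)) (A : AbelianSchemeOver S),
      (∀ s : S, ∃ (U : Scheme.{0}) (i : U ⟶ S) (_ : IsOpenImmersion i) (_ : s ∈ Set.range i.base)
          (B : AbelianSchemeOver U) (G : B.X.left ⟶ A.X.left), B.IsBaseChangeVia A i G ∧ IsProjective B.X.hom) →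
        Nonempty A.DualPair) :
    ∃ (𝓗 : SiegelFramedCovariant g N δ J) (jH : 𝓗.H.left ⟶ H₀) (_ : IsImmersion jH) (prH : 𝓗.univ.A.X.left ⟶ Z₀),
      𝓗.H.hom = jH ≫ f₀ ∧ IsPullback prH 𝓗.univ.A.X.hom p₀ jH ∧
      𝓗.emb = prH ≫ i₀ ≫ pullback.snd (terminal.from H₀) (terminal.from (projectiveSpaceInt J)) ∧
      𝓗.univ.A.unitSection ≫ prH = jH ≫ τ₀ (eι none) ∧ (∀ i, (𝓗.univ.level.σ i).left ≫ prH = jH ≫ τ₀ (eι (some i))) ∧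
      LocallyOfFiniteType 𝓗.H.hom := by
  classical
  -- STEP 2 (★ R-A): the universal triple of the MFK sub-functor over `H ↪ H₀`
  let ι₀ : Z₀ ⟶ projectiveSpaceInt J := i₀ ≫ pullback.snd (terminal.from H₀) (terminal.from (projectiveSpaceInt J))
  let κ : Fin (6 ^ g * polarizationDegree δ) ≃ Fin (Nat.card J + 1) := finCongr hJ.symm
  obtain ⟨u₀, hu₀⟩ := exists_hom_freeModule_app_eq ((Scheme.Modules.pushforward p₀).obj (twistMod ι₀ (unitModule Z₀) 1))
    (fun k => monomialSection ι₀ 1 fun _ => κ k)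
  obtain ⟨H, jH, hjH, P, hP, prH, sqH, hεH, hτH, hLR, LH, hLH, ΓH, hPH, hΓH₁, hΓH₂, hVH, -, hTpts⟩ :=
    exists_siegelUniversalTriple_clauses_iff_mfkIntrinsic f₀ p₀ ι₀ i₀ hp₀ rfl (τ₀ (eι none)) (hτ₀ _)
      (fun i => τ₀ (eι (some i))) (fun i => hτ₀ _) hN δ hδ κ u₀ hu₀ hII hF3
  haveI := hjH
  haveI : IsLocallyNoetherian H₀ := LocallyOfFiniteType.isLocallyNoetherian f₀
  haveI : IsLocallyNoetherian H := LocallyOfFiniteType.isLocallyNoetherian jH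
  refine ⟨{ H := Over.mk (jH ≫ f₀)
            isLocallyNoetherian := ‹IsLocallyNoetherian H›
            univ := P
            emb := prH ≫ ι₀
            isLinearRigidification_emb := hLR
            represents := fun T _ P' em hLR' => ?_ }, jH, hjH, prH, rfl, sqH, rfl, hεH, hτH, ?_⟩
  swap
  · change LocallyOfFiniteType (jH ≫ f₀)
    infer_instance
  /- === `represents` for a linearly rigidified `(P′, em)` over the locally Noetherian `ℚ`-scheme `T` === -/
  -- the raw letters used below
  have hL₀ : HasRank (twistMod ι₀ (unitModule Z₀) 1) 1 := hasRank_twistMod_unitModule ι₀ 1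
  have hsec : ∀ {S' : Scheme.{0}} (B : AbelianSchemeOver S') (s : B.Sections), s.left ≫ B.X.hom = 𝟙 S' := fun B s => by
    simp
  -- (a) the embedded family `j′ : X′ ⊂ 𝐏(J; T)`: closed, flat, Hilbert polynomial `(6e)^g d`, with `2g+1` sections
  let j' : P'.A.X.left ⟶ projectiveSpace J T.left := pullback.lift P'.A.X.hom em (terminal.hom_ext _ _)
  have hj'fst : j' ≫ projectiveSpaceFst J T.left = P'.A.X.hom := pullback.lift_fst _ _ _
  have hj'snd : j' ≫ pullback.snd (terminal.from T.left) (terminal.from (projectiveSpaceInt J)) = em := pullback.lift_snd _ _ _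
  haveI : IsClosedImmersion j' := hLR'.isClosedImmersion_lift J T.hom
  haveI : Flat (j' ≫ projectiveSpaceFst J T.left) := hLR'.flat_lift_comp_fst J
  have hrk' : ∀ e, e₀ ≤ e → HasRank ((Scheme.Modules.pushforward (j' ≫ projectiveSpaceFst J T.left)).obj
      (twistMod (j' ≫ pullback.snd (terminal.from T.left) (terminal.from (projectiveSpaceInt J))) (unitModule P'.A.X.left) e))
      ((6 * e) ^ g * polarizationDegree δ) :=
    fun e he => hLR'.hasRank_pushforward_twistMod_lift J T.hom (he₀.trans_le he)
  let σ : Fin n → (T.left ⟶ P'.A.X.left) :=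
    fun k => (eι.symm k).elim P'.A.unitSection fun i => (P'.level.σ i).left
  have hσval : ∀ o, σ (eι o) = o.elim P'.A.unitSection fun i => (P'.level.σ i).left := fun o => by
    simp only [σ, Equiv.symm_apply_apply]
  have hσ : ∀ k, σ k ≫ j' ≫ projectiveSpaceFst J T.left = 𝟙 T.left := by
    intro k
    obtain ⟨o, rfl⟩ := eι.surjective k
    rw [hj'fst, hσval]
    cases o with
    | none => exact P'.A.unitSection_comp_hom
    | some i => exact hsec P'.A (P'.level.σ i)
  -- (b) the classifying `ℚ`-morphism `b : T → H₀` of the embedded family with sections (★ R-C1)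
  obtain ⟨b, ⟨hbf, pr, sqb, hprι, hprσ⟩, hbu⟩ := hunivS T.hom j' hrk' σ hσ
  have sqb' : IsPullback pr P'.A.X.hom p₀ b := by rw [← hj'fst]; exact sqb
  have hprem : pr ≫ ι₀ = em := by
    change pr ≫ i₀ ≫ _ = em
    rw [hprι, hj'snd]
  have hunit' : P'.A.unitSection ≫ pr = b ≫ τ₀ (eι none) := by
    simpa only [hσval, Option.elim_none] using hprσ (eι none)
  have hσ' : ∀ i, (P'.level.σ i).left ≫ pr = b ≫ τ₀ (eι (some i)) := fun i => by
    simpa only [hσval, Option.elim_some] using hprσ (eι (some i))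
  -- (c) INT(b) (★ R-B2b; the second normalisation of `P′` is the edition-2 field)
  have hP'unit : Nonempty ((Scheme.Modules.pullback (DualPair.unitHatSlice P'.D)).obj P'.D.P ≅ SheafOfModules.unit _) :=
    P'.hatNormalised
  have hLRpr : P'.IsLinearRigidification J (pr ≫ ι₀) := by rw [hprem]; exact hLR'
  have hINT := PolarizedAbelianSchemeWithLevel.mfkIntrinsic_of_isLinearRigidification p₀ ι₀ κ u₀ hu₀ (τ₀ (eι none))
    (fun i => τ₀ (eι (some i))) P' hP'unit b pr sqb' hLRpr hunit' hσ'
  -- (d) the classifying `w : T → H` (★ R-A)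
  obtain ⟨w, hwb, hwu⟩ := (hTpts b).2 hINT
  -- (e) the comparison: `G : X′ → univ.X` cartesian over `w`, `X′ ≅ univ.X ×_H T` over `T`
  have hcomm : pr ≫ p₀ = (P'.A.X.hom ≫ w) ≫ jH := by rw [sqb'.w, Category.assoc, hwb]
  let G : P'.A.X.left ⟶ P.A.X.left := sqH.lift pr (P'.A.X.hom ≫ w) hcomm
  have hGpr : G ≫ prH = pr := sqH.lift_fst _ _ _
  have hGπ : G ≫ P.A.X.hom = P'.A.X.hom ≫ w := sqH.lift_snd _ _ _
  have sqGbig : IsPullback (G ≫ prH) P'.A.X.hom p₀ (w ≫ jH) := by rw [hGpr, hwb]; exact sqb'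
  have sqG : IsPullback G P'.A.X.hom P.A.X.hom w := IsPullback.of_right sqGbig hGπ sqH
  have hGem : G ≫ prH ≫ ι₀ = em := by rw [← Category.assoc, hGpr, hprem]
  -- sections through `G`
  have hGunit : P'.A.unitSection ≫ G = w ≫ P.A.unitSection := by
    apply sqH.hom_ext
    · rw [Category.assoc, hGpr, hunit', Category.assoc, hεH, ← Category.assoc, hwb]
    · rw [Category.assoc, hGπ, ← Category.assoc, P'.A.unitSection_comp_hom, Category.id_comp, Category.assoc,
        P.A.unitSection_comp_hom, Category.comp_id]
  have hGσ : ∀ i, (P'.level.σ i).left ≫ G = w ≫ (P.level.σ i).left := fun i => by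
    apply sqH.hom_ext
    · rw [Category.assoc, hGpr, hσ' i, Category.assoc, hτH i, ← Category.assoc, hwb]
    · rw [Category.assoc, hGπ, ← Category.assoc, hsec P'.A (P'.level.σ i), Category.assoc, hsec P.A (P.level.σ i)]
      exact (Category.id_comp _).trans (Category.comp_id _).symm
  -- the isomorphism of `T`-schemes `e : X′ ≅ (univ ×_H T).X`
  let e : P'.A.X ≅ (P.A.baseChange w).X :=
    Over.isoMk sqG.isoPullback (by
      change sqG.isoPullback.hom ≫ pullback.snd P.A.X.hom w = P'.A.X.hom
      exact sqG.isoPullback_hom_snd)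
  have he_left : e.hom.left = sqG.isoPullback.hom := rfl
  have he_fst : e.hom.left ≫ pullback.fst P.A.X.hom w = G := sqG.isoPullback_hom_fst
  have he_snd : e.hom.left ≫ pullback.snd P.A.X.hom w = P'.A.X.hom := sqG.isoPullback_hom_snd
  -- unit and level sections match under `e`
  have hηleft : P'.A.unitSection ≫ e.hom.left = (P.A.baseChange w).unitSection := by
    apply pullback.hom_ext
    · rw [Category.assoc, he_fst, hGunit, (P.A).unitSection_baseChange_comp_fst]
    · rw [Category.assoc, he_snd, P'.A.unitSection_comp_hom]
      exact ((P.A.baseChange w).unitSection_comp_hom).symm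
  have hηe : η[P'.A.X] ≫ e.hom = η[(P.baseChange w).A.X] := Over.OverMorphism.ext hηleft
  have hσe : ∀ i, P'.level.σ i ≫ e.hom = (P.baseChange w).level.σ i := fun i => by
    apply Over.OverMorphism.ext
    change (P'.level.σ i).left ≫ e.hom.left = (P.A.sectionBaseChange w (P.level.σ i)).left
    apply pullback.hom_ext
    · rw [Category.assoc, he_fst, hGσ i, sectionBaseChange_left_comp_fst]
    · rw [Category.assoc, he_snd, hsec P'.A (P'.level.σ i)]
      exact (hsec (P.A.baseChange w) (P.A.sectionBaseChange w (P.level.σ i))).symm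
  -- the second normalisations
  have h₂ : Nonempty ((Scheme.Modules.pullback (DualPair.unitHatSlice (P.baseChange w).D)).obj (P.baseChange w).D.P ≅
      SheafOfModules.unit _) :=
    DualPair.nonempty_unitHatSlice_baseChange_iso P.D hP
  -- the graphs
  let Γ₁ : P'.A.X.left ⟶ P'.A.prodLeft P'.D.hat :=
    pullback.lift (𝟙 _) P'.pol.lam.left (by rw [Category.id_comp]; exact (Over.w P'.pol.lam).symm)
  have hΓ₁₁ : Γ₁ ≫ pullback.fst _ _ = 𝟙 _ := pullback.lift_fst _ _ _
  have hΓ₁₂ : Γ₁ ≫ pullback.snd _ _ = P'.pol.lam.left := pullback.lift_snd _ _ _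
  let Γ₂ : (P.baseChange w).A.X.left ⟶ (P.baseChange w).A.prodLeft (P.baseChange w).D.hat :=
    pullback.lift (𝟙 _) (P.baseChange w).pol.lam.left (by rw [Category.id_comp]; exact (Over.w (P.baseChange w).pol.lam).symm)
  have hΓ₂₁ : Γ₂ ≫ pullback.fst _ _ = 𝟙 _ := pullback.lift_fst _ _ _
  have hΓ₂₂ : Γ₂ ≫ pullback.snd _ _ = (P.baseChange w).pol.lam.left := pullback.lift_snd _ _ _
  -- the (V) letters (★ R-B2a) on both sides
  have hLb : HasRank ((Scheme.Modules.pullback pr).obj (twistMod ι₀ (unitModule Z₀) 1)) 1 := hasRank_pullback pr hL₀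
  have hL₁ := P'.A.hasRank_normalised _ hLb
  have hε₁ := P'.A.cechPic_pullback_unitSection_detClass_normalised _ hLb (HasRank.isFiniteLocallyFree' hL₁)
  have hV₁ := P'.nonempty_normalised_iso_LDelta_tensorPow_of_isLinearRigidification J ι₀ hLRpr pr rfl Γ₁ hΓ₁₁ hΓ₁₂
  have hLR₂ : (P.baseChange w).IsLinearRigidification J ((pullback.fst P.A.X.hom w ≫ prH) ≫ ι₀) := by
    rw [Category.assoc]; exact hLR.baseChange w
  have hV₂ := (P.baseChange w).nonempty_normalised_iso_LDelta_tensorPow_of_isLinearRigidification J ι₀ hLR₂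
    (pullback.fst P.A.X.hom w ≫ prH) rfl Γ₂ hΓ₂₁ hΓ₂₂
  -- `L₁ ≅ e^*L₂`
  have hM₂ : HasRank ((Scheme.Modules.pullback (pullback.fst P.A.X.hom w ≫ prH)).obj (twistMod ι₀ (unitModule Z₀) 1)) 1 :=
    hasRank_pullback _ hL₀
  have hcompG : e.hom.left ≫ pullback.fst P.A.X.hom w ≫ prH = pr := by rw [← Category.assoc, he_fst, hGpr]
  obtain ⟨n₁⟩ := nonempty_pullback_normalised_iso_of_comp_eq (A := (P.baseChange w).A) (A' := P'.A) e.hom.left he_snd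
    hηleft hM₂
  obtain ⟨n₂⟩ := P'.A.nonempty_normalised_iso_of_iso
    ((Scheme.Modules.pullbackComp e.hom.left (pullback.fst P.A.X.hom w ≫ prH)).app _ ≪≫
      (Scheme.Modules.pullbackCongr hcompG).app _) (hasRank_pullback _ hM₂)
  have hL : Nonempty (_ ≅ (Scheme.Modules.pullback e.hom.left).obj _) := ⟨(n₁ ≪≫ n₂).symm⟩
  -- [MumfordFogartyKirwan1994] Prop. 7.3 «Φ injective» in triple currency (★ (C1)), then compose with the base change
  obtain ⟨Ĝ₁, hrel₁⟩ := PolarizedAbelianSchemeWithLevel.exists_isBaseChangeVia_id_of_iso (six_residueField_ne_zero T.hom)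
    P' (P.baseChange w) e hηe hP'unit h₂ Γ₁ hΓ₁₁ hΓ₁₂ Γ₂ hΓ₂₁ hΓ₂₂ hL₁ hε₁ hV₁ hV₂ hL hσe
  have hrel : P'.IsBaseChangeVia P w G (Ĝ₁ ≫ pullback.fst P.D.hat.X.hom w) := by
    have h := hrel₁.trans (P.baseChange_isBaseChangeVia w)
    rw [Category.id_comp, he_fst] at h
    exact h
  -- the classifying `ℚ`-morphism
  have hwf : w ≫ (Over.mk (jH ≫ f₀) : SchemeOver ℚ).hom = T.hom := by
    change w ≫ jH ≫ f₀ = T.hom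
    rw [← Category.assoc, hwb, hbf]
  refine ⟨Over.homMk w hwf, ⟨G, Ĝ₁ ≫ pullback.fst P.D.hat.X.hom w, hrel, hGem⟩, ?_⟩
  -- (f) uniqueness
  rintro f₁ ⟨G₁, Ĝ₁', hrel₁', hG₁⟩
  apply Over.OverMorphism.ext
  change f₁.left = w
  obtain ⟨⟨w₁, hpb₁, hη₁, -⟩, hσ₁⟩ := hrel₁'.1
  have hb₁f : (f₁.left ≫ jH) ≫ f₀ = T.hom := by rw [Category.assoc]; exact Over.w f₁
  have sq₁ : IsPullback (G₁ ≫ prH) (j' ≫ projectiveSpaceFst J T.left) p₀ (f₁.left ≫ jH) := by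
    rw [hj'fst]; exact hpb₁.paste_horiz sqH
  have hG₁ι : (G₁ ≫ prH) ≫ i₀ ≫ pullback.snd (terminal.from H₀) (terminal.from (projectiveSpaceInt J)) =
      j' ≫ pullback.snd (terminal.from T.left) (terminal.from (projectiveSpaceInt J)) := by
    rw [hj'snd, Category.assoc]
    exact hG₁
  have hG₁σ : ∀ k, σ k ≫ G₁ ≫ prH = (f₁.left ≫ jH) ≫ τ₀ k := by
    intro k
    obtain ⟨o, rfl⟩ := eι.surjective k
    rw [hσval]
    cases o with
    | none =>
      change P'.A.unitSection ≫ G₁ ≫ prH = _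
      rw [← Category.assoc, show P'.A.unitSection ≫ G₁ = f₁.left ≫ P.A.unitSection from hη₁, Category.assoc, hεH,
        Category.assoc]
    | some i =>
      change (P'.level.σ i).left ≫ G₁ ≫ prH = _
      rw [← Category.assoc, hσ₁ i, Category.assoc, hτH i, Category.assoc]
  have hb₁ : f₁.left ≫ jH = b := hbu _ ⟨hb₁f, G₁ ≫ prH, sq₁, hG₁ι, fun k => by rw [← Category.assoc]; exact hG₁σ k⟩
  exact hwu _ hb₁


/-- **[MumfordFogartyKirwan1994] Prop. 7.3 / Prop. 7.6 — THE LINEARLY RIGIDIFIED COVARIANT `H` EXISTS, modulo the Hilbert scheme of `𝐏^J`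
(`hHilb`), Theorem 6.14 (`hII`) and Corollary 6.8 (`hF3`).**  For `N ≠ 0`, a polarisation type `δ`, a finite index type `J` with
`#J + 1 = 6^g · d` (`d = ∏ δᵢ`, the rank of `π_*(L^Δ(λ)³)`), there is a ★ (8α) `SiegelFramedCovariant g N δ J`: a locally Noetherian
`ℚ`-scheme `H` with a universal polarised abelian scheme with symplectic-liftable level-`N` structure and a universal linear rigidification
`emb : univ.X → 𝐏^J_ℤ`, such that every linearly rigidified triple over a locally Noetherian `ℚ`-scheme is its pull-back along a UNIQUE
`T → H` ([MumfordFogartyKirwan1994] Prop. 7.6: «`H` represents the functor of polarised abelian schemes with level structure and linear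
rigidification»).  This is the F-6 exit of the cell's tower, the input `𝓗` of the slice construction of the fine moduli scheme (F-8) and
of the registry core `hHrep`.
[cite: MumfordFogartyKirwan1994, Ch. 7 §2 Proposition 7.3 (p. 132; proof pp. 132–134)] [cite: MumfordFogartyKirwan1994, Ch. 7 §2 Prop. 7.6 (p. 136)]
[cite: MumfordFogartyKirwan1994, Ch. 6 §3 Theorem 6.14 (p. 124)] [cite: MumfordFogartyKirwan1994, Ch. 6 §1 Corollary 6.8 (p. 118)]
[cite: MumfordFogartyKirwan1994, Ch. 0 §5 (c) (p. 23)] -/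
theorem nonempty_siegelFramedCovariant_of_cores {g N : ℕ} {δ : Fin g → ℕ} (hN : N ≠ 0) (hδ : IsPolarizationType δ)
    {J : Type} [Finite J] (hJ : Nat.card J + 1 = 6 ^ g * polarizationDegree δ)
    -- `hHilb⁺`: the universal flat family of the Hilbert scheme of `𝐏^J` for the polynomial `(6e)^g d` = the CONCLUSION of
    -- ★ F-5 ⑦b `exists_universal_flat_family_of_vanishingLocus` VERBATIM at `ι := J`, `R e := (6e)^g d` (with its `d k e₀`, `e₀ > 0`, and its representability
    -- instance as an explicit conjunct — ★ `isRepresentable_grassmannianSheaf _ k` discharges it)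
    (hHilb : ∃ (d k e₀ : ℕ) (_ : 0 < e₀) (_ : (grassmannianSheaf ((Fin d → Fin (Nat.card J + 1)) →₀ ℤ) k).obj.IsRepresentable)
      (H₁ : Scheme.{0}) (j : H₁ ⟶ grassmannianScheme ((Fin d → Fin (Nat.card J + 1)) →₀ ℤ) k) (_ : IsImmersion j) (_ : IsLocallyNoetherian H₁)
      (ZH : Scheme.{0}) (iH : ZH ⟶ projectiveSpace J H₁) (_ : IsClosedImmersion iH),
      (Flat (iH ≫ projectiveSpaceFst J H₁) ∧
        ∀ e, e₀ ≤ e → HasRank ((Scheme.Modules.pushforward (iH ≫ projectiveSpaceFst J H₁)).obj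
          (twistMod (iH ≫ pullback.snd (terminal.from H₁) (terminal.from (projectiveSpaceInt J))) (unitModule ZH) e))
          ((6 * e) ^ g * polarizationDegree δ)) ∧
      ∀ ⦃T : Scheme.{0}⦄ [IsLocallyNoetherian T] ⦃X : Scheme.{0}⦄ (i : X ⟶ projectiveSpace J T)
        [IsClosedImmersion i] [Flat (i ≫ projectiveSpaceFst J T)],
        (∀ e, e₀ ≤ e → HasRank ((Scheme.Modules.pushforward (i ≫ projectiveSpaceFst J T)).obj
          (twistMod (i ≫ pullback.snd (terminal.from T) (terminal.from (projectiveSpaceInt J))) (unitModule X) e))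
          ((6 * e) ^ g * polarizationDegree δ)) →
        ∃! v : T ⟶ H₁, ∃ e : X ⟶ ZH, IsPullback e i iH (projectiveSpaceMap J v))
    -- `hII` ([MumfordFogartyKirwan1994] Thm. 6.14 with the group law as output DATA; letter of ★ FILE 2 / ★ R-A, verbatim)
    (hII : ∀ ⦃H₁ Z₁ : Scheme.{0}⦄ (p₁ : Z₁ ⟶ H₁) [IsProper p₁] [Smooth p₁] [GeometricallyConnected p₁]
        (f₁ : H₁ ⟶ Spec (.of ℚ)) [LocallyOfFiniteType f₁] (ε₁ : H₁ ⟶ Z₁) (_ : ε₁ ≫ p₁ = 𝟙 H₁),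
      ∃ (H₂ : Scheme.{0}) (j₂ : H₂ ⟶ H₁) (_ : IsOpenImmersion j₂) (_ : IsClosed (Set.range j₂))
        (G : GrpObj (Over.mk (pullback.snd p₁ j₂))),
          (@MonObj.one _ _ _ (Over.mk (pullback.snd p₁ j₂)) G.toMonObj).left ≫ pullback.fst p₁ j₂ = j₂ ≫ ε₁ ∧
          SmoothOfRelativeDimension g (pullback.snd p₁ j₂) ∧
          ∀ ⦃T : Scheme.{0}⦄ (v : T ⟶ H₁),
            (∃! w : T ⟶ H₂, w ≫ j₂ = v) ↔
              ∃ G' : GrpObj (Over.mk (pullback.snd p₁ v)),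
                (@MonObj.one _ _ _ (Over.mk (pullback.snd p₁ v)) G'.toMonObj).left ≫ pullback.fst p₁ v = v ≫ ε₁ ∧
                SmoothOfRelativeDimension g (pullback.snd p₁ v))
    -- `hF3` ([MumfordFogartyKirwan1994] Cor. 6.8 Zariski-locally on the base; letter of ★ FILE 2 / ★ R-A, verbatim)
    (hF3 : ∀ ⦃S : Scheme.{0}⦄ [IsLocallyNoetherian S] (fS : S ⟶ Spec (.of ℚ)) (A : AbelianSchemeOver S),
      (∀ s : S, ∃ (U : Scheme.{0}) (i : U ⟶ S) (_ : IsOpenImmersion i) (_ : s ∈ Set.range i.base)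
          (B : AbelianSchemeOver U) (G : B.X.left ⟶ A.X.left), B.IsBaseChangeVia A i G ∧ IsProjective B.X.hom) →
        Nonempty A.DualPair) :
    Nonempty (SiegelFramedCovariant g N δ J) := by
  classical
  obtain ⟨d, k, e₀, he₀, hrep, H₁, j, hj, hH₁, ZH, iH, hiH, ⟨hflat, -⟩, huniv⟩ := hHilb
  haveI := hrep
  haveI := hj
  haveI := hiH
  haveI := hflat
  -- the Hilbert image is locally of finite type over `ℤ` (immersion into the Grassmannian, ★ `GrassmannianSchemeProper`)
  haveI : LocallyOfFiniteType (terminal.from H₁) := by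
    rw [← terminal.comp_from j]
    haveI := Grassmannian.locallyOfFiniteType_terminal_from ((Fin d → Fin (Nat.card J + 1)) →₀ ℤ) k
    infer_instance
  -- STEP 1 (★ R-C1): the raw base `Hilb^{P, 2g+1}_ℚ` with its universal family and tautological sections
  let eι : Option (Fin g ⊕ Fin g) ≃ Fin (Fintype.card (Option (Fin g ⊕ Fin g))) := Fintype.equivFin _
  obtain ⟨H₀, Z₀, f₀, hf₀, p₀, i₀, hi₀, hp₀, hflat₀, τ₀, hτ₀, hunivS⟩ :=
    exists_hilbertBase_with_sections
      (fun T X (i : X ⟶ projectiveSpace J T) => ∀ e, e₀ ≤ e →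
        HasRank ((Scheme.Modules.pushforward (i ≫ projectiveSpaceFst J T)).obj
          (twistMod (i ≫ pullback.snd (terminal.from T) (terminal.from (projectiveSpaceInt J))) (unitModule X) e))
          ((6 * e) ^ g * polarizationDegree δ))
      iH huniv (Spec (.of ℚ)) (Fintype.card (Option (Fin g ⊕ Fin g)))
  haveI := hf₀
  haveI := hi₀
  haveI := hflat₀
  exact ⟨(exists_siegelFramedCovariant_of_hilbertBase hN hδ hJ he₀ f₀ p₀ i₀ hp₀ eι τ₀ hτ₀ hunivS hII hF3).choose⟩

/-- **The same with `H → Spec ℚ` locally of finite type** (the input letter of the F-12 registry's `hF9`).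
[cite: MumfordFogartyKirwan1994, Ch. 7 §2 Proposition 7.3 (p. 132; proof pp. 132–134)] -/
theorem exists_siegelFramedCovariant_locallyOfFiniteType_of_cores {g N : ℕ} {δ : Fin g → ℕ} (hN : N ≠ 0)
    (hδ : IsPolarizationType δ) {J : Type} [Finite J] (hJ : Nat.card J + 1 = 6 ^ g * polarizationDegree δ)
    -- `hHilb⁺`: the universal flat family of the Hilbert scheme of `𝐏^J` for the polynomial `(6e)^g d` = the CONCLUSION of
    -- ★ F-5 ⑦b `exists_universal_flat_family_of_vanishingLocus` VERBATIM at `ι := J`, `R e := (6e)^g d` (with its `d k e₀`, `e₀ > 0`, and its representability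
    -- instance as an explicit conjunct — ★ `isRepresentable_grassmannianSheaf _ k` discharges it)
    (hHilb : ∃ (d k e₀ : ℕ) (_ : 0 < e₀) (_ : (grassmannianSheaf ((Fin d → Fin (Nat.card J + 1)) →₀ ℤ) k).obj.IsRepresentable)
      (H₁ : Scheme.{0}) (j : H₁ ⟶ grassmannianScheme ((Fin d → Fin (Nat.card J + 1)) →₀ ℤ) k) (_ : IsImmersion j) (_ : IsLocallyNoetherian H₁)
      (ZH : Scheme.{0}) (iH : ZH ⟶ projectiveSpace J H₁) (_ : IsClosedImmersion iH),
      (Flat (iH ≫ projectiveSpaceFst J H₁) ∧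
        ∀ e, e₀ ≤ e → HasRank ((Scheme.Modules.pushforward (iH ≫ projectiveSpaceFst J H₁)).obj
          (twistMod (iH ≫ pullback.snd (terminal.from H₁) (terminal.from (projectiveSpaceInt J))) (unitModule ZH) e))
          ((6 * e) ^ g * polarizationDegree δ)) ∧
      ∀ ⦃T : Scheme.{0}⦄ [IsLocallyNoetherian T] ⦃X : Scheme.{0}⦄ (i : X ⟶ projectiveSpace J T)
        [IsClosedImmersion i] [Flat (i ≫ projectiveSpaceFst J T)],
        (∀ e, e₀ ≤ e → HasRank ((Scheme.Modules.pushforward (i ≫ projectiveSpaceFst J T)).obj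
          (twistMod (i ≫ pullback.snd (terminal.from T) (terminal.from (projectiveSpaceInt J))) (unitModule X) e))
          ((6 * e) ^ g * polarizationDegree δ)) →
        ∃! v : T ⟶ H₁, ∃ e : X ⟶ ZH, IsPullback e i iH (projectiveSpaceMap J v))
    -- `hII` ([MumfordFogartyKirwan1994] Thm. 6.14 with the group law as output DATA; letter of ★ FILE 2 / ★ R-A, verbatim)
    (hII : ∀ ⦃H₁ Z₁ : Scheme.{0}⦄ (p₁ : Z₁ ⟶ H₁) [IsProper p₁] [Smooth p₁] [GeometricallyConnected p₁]
        (f₁ : H₁ ⟶ Spec (.of ℚ)) [LocallyOfFiniteType f₁] (ε₁ : H₁ ⟶ Z₁) (_ : ε₁ ≫ p₁ = 𝟙 H₁),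
      ∃ (H₂ : Scheme.{0}) (j₂ : H₂ ⟶ H₁) (_ : IsOpenImmersion j₂) (_ : IsClosed (Set.range j₂))
        (G : GrpObj (Over.mk (pullback.snd p₁ j₂))),
          (@MonObj.one _ _ _ (Over.mk (pullback.snd p₁ j₂)) G.toMonObj).left ≫ pullback.fst p₁ j₂ = j₂ ≫ ε₁ ∧
          SmoothOfRelativeDimension g (pullback.snd p₁ j₂) ∧
          ∀ ⦃T : Scheme.{0}⦄ (v : T ⟶ H₁),
            (∃! w : T ⟶ H₂, w ≫ j₂ = v) ↔
              ∃ G' : GrpObj (Over.mk (pullback.snd p₁ v)),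
                (@MonObj.one _ _ _ (Over.mk (pullback.snd p₁ v)) G'.toMonObj).left ≫ pullback.fst p₁ v = v ≫ ε₁ ∧
                SmoothOfRelativeDimension g (pullback.snd p₁ v))
    -- `hF3` ([MumfordFogartyKirwan1994] Cor. 6.8 Zariski-locally on the base; letter of ★ FILE 2 / ★ R-A, verbatim)
    (hF3 : ∀ ⦃S : Scheme.{0}⦄ [IsLocallyNoetherian S] (fS : S ⟶ Spec (.of ℚ)) (A : AbelianSchemeOver S),
      (∀ s : S, ∃ (U : Scheme.{0}) (i : U ⟶ S) (_ : IsOpenImmersion i) (_ : s ∈ Set.range i.base)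
          (B : AbelianSchemeOver U) (G : B.X.left ⟶ A.X.left), B.IsBaseChangeVia A i G ∧ IsProjective B.X.hom) →
        Nonempty A.DualPair) :
    ∃ 𝓗 : SiegelFramedCovariant g N δ J, LocallyOfFiniteType 𝓗.H.hom := by
  classical
  obtain ⟨d, k, e₀, he₀, hrep, H₁, j, hj, hH₁, ZH, iH, hiH, ⟨hflat, -⟩, huniv⟩ := hHilb
  haveI := hrep
  haveI := hj
  haveI := hiH
  haveI := hflat
  -- the Hilbert image is locally of finite type over `ℤ` (immersion into the Grassmannian, ★ `GrassmannianSchemeProper`)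
  haveI : LocallyOfFiniteType (terminal.from H₁) := by
    rw [← terminal.comp_from j]
    haveI := Grassmannian.locallyOfFiniteType_terminal_from ((Fin d → Fin (Nat.card J + 1)) →₀ ℤ) k
    infer_instance
  -- STEP 1 (★ R-C1): the raw base `Hilb^{P, 2g+1}_ℚ` with its universal family and tautological sections
  let eι : Option (Fin g ⊕ Fin g) ≃ Fin (Fintype.card (Option (Fin g ⊕ Fin g))) := Fintype.equivFin _
  obtain ⟨H₀, Z₀, f₀, hf₀, p₀, i₀, hi₀, hp₀, hflat₀, τ₀, hτ₀, hunivS⟩ :=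
    exists_hilbertBase_with_sections
      (fun T X (i : X ⟶ projectiveSpace J T) => ∀ e, e₀ ≤ e →
        HasRank ((Scheme.Modules.pushforward (i ≫ projectiveSpaceFst J T)).obj
          (twistMod (i ≫ pullback.snd (terminal.from T) (terminal.from (projectiveSpaceInt J))) (unitModule X) e))
          ((6 * e) ^ g * polarizationDegree δ))
      iH huniv (Spec (.of ℚ)) (Fintype.card (Option (Fin g ⊕ Fin g)))
  haveI := hf₀
  haveI := hi₀
  haveI := hflat₀
  obtain ⟨𝓗, -, -, -, -, -, -, -, -, hlft⟩ :=
    exists_siegelFramedCovariant_of_hilbertBase hN hδ hJ he₀ f₀ p₀ i₀ hp₀ eι τ₀ hτ₀ hunivS hII hF3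
  exact ⟨𝓗, hlft⟩

/-! ## §4 (edition 2) The framed covariant FROM THE CORES `{II, F3}` ALONE: `hHilb⁺` discharged BY NAME
by the closed Hilbert scheme ★ F-5 ⑦b ed. 4 `exists_grassmannianImmersion_universal_flat_family` (at `ι := J`,
`P := (6^g d)·X^g`, `e₁ := 1`, `R e := (6e)^g d`). -/

/-- **The framed covariant exists and is locally of finite type over `ℚ`, from the two cores `(II)` and `(F3)` alone**
([MumfordFogartyKirwan1994] Prop. 7.3 / 7.6 with Ch. 0 §5 (c)): the Hilbert-scheme input `hHilb⁺` of
`exists_siegelFramedCovariant_locallyOfFiniteType_of_cores` is the closed theorem ★ `exists_grassmannianImmersion_universal_flat_family`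
for the polynomial `(6^g d)·X^g` (needs `#J ≥ 1`, automatic for `g ≥ 1`).
[cite: MumfordFogartyKirwan1994, Ch. 7 §2 Proposition 7.3 (p. 132; proof pp. 132–134)] [cite: MumfordFogartyKirwan1994, Ch. 0 §5 (c) (p. 23)] -/
theorem exists_siegelFramedCovariant_locallyOfFiniteType_of_cores' {g N : ℕ} {δ : Fin g → ℕ} (hN : N ≠ 0)
    (hδ : IsPolarizationType δ) {J : Type} [Finite J] (hJ : Nat.card J + 1 = 6 ^ g * polarizationDegree δ) (hn : 1 ≤ Nat.card J)
    -- `hII` ([MumfordFogartyKirwan1994] Thm. 6.14 with the group law as output DATA; letter of ★ FILE 2 / ★ R-A, verbatim)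
    (hII : ∀ ⦃H₁ Z₁ : Scheme.{0}⦄ (p₁ : Z₁ ⟶ H₁) [IsProper p₁] [Smooth p₁] [GeometricallyConnected p₁]
        (f₁ : H₁ ⟶ Spec (.of ℚ)) [LocallyOfFiniteType f₁] (ε₁ : H₁ ⟶ Z₁) (_ : ε₁ ≫ p₁ = 𝟙 H₁),
      ∃ (H₂ : Scheme.{0}) (j₂ : H₂ ⟶ H₁) (_ : IsOpenImmersion j₂) (_ : IsClosed (Set.range j₂))
        (G : GrpObj (Over.mk (pullback.snd p₁ j₂))),
          (@MonObj.one _ _ _ (Over.mk (pullback.snd p₁ j₂)) G.toMonObj).left ≫ pullback.fst p₁ j₂ = j₂ ≫ ε₁ ∧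
          SmoothOfRelativeDimension g (pullback.snd p₁ j₂) ∧
          ∀ ⦃T : Scheme.{0}⦄ (v : T ⟶ H₁),
            (∃! w : T ⟶ H₂, w ≫ j₂ = v) ↔
              ∃ G' : GrpObj (Over.mk (pullback.snd p₁ v)),
                (@MonObj.one _ _ _ (Over.mk (pullback.snd p₁ v)) G'.toMonObj).left ≫ pullback.fst p₁ v = v ≫ ε₁ ∧
                SmoothOfRelativeDimension g (pullback.snd p₁ v))
    -- `hF3` ([MumfordFogartyKirwan1994] Cor. 6.8 Zariski-locally on the base; letter of ★ FILE 2 / ★ R-A, verbatim)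
    (hF3 : ∀ ⦃S : Scheme.{0}⦄ [IsLocallyNoetherian S] (fS : S ⟶ Spec (.of ℚ)) (A : AbelianSchemeOver S),
      (∀ s : S, ∃ (U : Scheme.{0}) (i : U ⟶ S) (_ : IsOpenImmersion i) (_ : s ∈ Set.range i.base)
          (B : AbelianSchemeOver U) (G : B.X.left ⟶ A.X.left), B.IsBaseChangeVia A i G ∧ IsProjective B.X.hom) →
        Nonempty A.DualPair) :
    ∃ 𝓗 : SiegelFramedCovariant g N δ J, LocallyOfFiniteType 𝓗.H.hom := by
  obtain ⟨d, k, e₀, he₀, -, hrep, H, j, hj, hH, ZH, iH, hiH, hcore⟩ :=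
    exists_grassmannianImmersion_universal_flat_family hn (Polynomial.C ((6 : ℚ) ^ g * polarizationDegree δ) * Polynomial.X ^ g) 1
      (fun e => (6 * e) ^ g * polarizationDegree δ)
      (fun e _ => by push_cast; simp [Polynomial.eval_mul, Polynomial.eval_pow, Polynomial.eval_C, Polynomial.eval_X, mul_pow]; ring)
  exact exists_siegelFramedCovariant_locallyOfFiniteType_of_cores hN hδ hJ
    ⟨d, k, e₀, he₀, hrep, H, j, hj, hH, ZH, iH, hiH, hcore⟩ hII hF3

/-- **`Nonempty (SiegelFramedCovariant g N δ J)` from the cores `(II)`, `(F3)` alone** (`#J ≥ 1`).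
[cite: MumfordFogartyKirwan1994, Ch. 7 §2 Proposition 7.3 (p. 132; proof pp. 132–134)] -/
theorem nonempty_siegelFramedCovariant_of_cores' {g N : ℕ} {δ : Fin g → ℕ} (hN : N ≠ 0)
    (hδ : IsPolarizationType δ) {J : Type} [Finite J] (hJ : Nat.card J + 1 = 6 ^ g * polarizationDegree δ) (hn : 1 ≤ Nat.card J)
    -- `hII` ([MumfordFogartyKirwan1994] Thm. 6.14 with the group law as output DATA; letter of ★ FILE 2 / ★ R-A, verbatim)
    (hII : ∀ ⦃H₁ Z₁ : Scheme.{0}⦄ (p₁ : Z₁ ⟶ H₁) [IsProper p₁] [Smooth p₁] [GeometricallyConnected p₁]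
        (f₁ : H₁ ⟶ Spec (.of ℚ)) [LocallyOfFiniteType f₁] (ε₁ : H₁ ⟶ Z₁) (_ : ε₁ ≫ p₁ = 𝟙 H₁),
      ∃ (H₂ : Scheme.{0}) (j₂ : H₂ ⟶ H₁) (_ : IsOpenImmersion j₂) (_ : IsClosed (Set.range j₂))
        (G : GrpObj (Over.mk (pullback.snd p₁ j₂))),
          (@MonObj.one _ _ _ (Over.mk (pullback.snd p₁ j₂)) G.toMonObj).left ≫ pullback.fst p₁ j₂ = j₂ ≫ ε₁ ∧
          SmoothOfRelativeDimension g (pullback.snd p₁ j₂) ∧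
          ∀ ⦃T : Scheme.{0}⦄ (v : T ⟶ H₁),
            (∃! w : T ⟶ H₂, w ≫ j₂ = v) ↔
              ∃ G' : GrpObj (Over.mk (pullback.snd p₁ v)),
                (@MonObj.one _ _ _ (Over.mk (pullback.snd p₁ v)) G'.toMonObj).left ≫ pullback.fst p₁ v = v ≫ ε₁ ∧
                SmoothOfRelativeDimension g (pullback.snd p₁ v))
    -- `hF3` ([MumfordFogartyKirwan1994] Cor. 6.8 Zariski-locally on the base; letter of ★ FILE 2 / ★ R-A, verbatim)
    (hF3 : ∀ ⦃S : Scheme.{0}⦄ [IsLocallyNoetherian S] (fS : S ⟶ Spec (.of ℚ)) (A : AbelianSchemeOver S),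
      (∀ s : S, ∃ (U : Scheme.{0}) (i : U ⟶ S) (_ : IsOpenImmersion i) (_ : s ∈ Set.range i.base)
          (B : AbelianSchemeOver U) (G : B.X.left ⟶ A.X.left), B.IsBaseChangeVia A i G ∧ IsProjective B.X.hom) →
        Nonempty A.DualPair) :
    Nonempty (SiegelFramedCovariant g N δ J) := by
  obtain ⟨𝓗, -⟩ := exists_siegelFramedCovariant_locallyOfFiniteType_of_cores' hN hδ hJ hn hII hF3
  exact ⟨𝓗⟩

end Literature.AlgebraicGeometry.ModuliOfAbelianVarieties

end
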